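import Literature.AnabelianGeometry.SemiGraphs.QuasiTemperoidsQDPairs
import Literature.AlgebraicGeometry.Frobenioids.QuasiTemperoidConnected
import HarnessLib

/-!
# Semi-graphs of anabelioids, Appendix: quotients of QD-pairs EXIST in `B^temp(Π)` (and when they
# exist in `B^temp(Π)[A]`) — the orbit-space construction behind Definition A.3 (iii)

Mochizuki, *Semi-graphs of anabelioids*, Publ. RIMS **42** (2006) 221–322, Appendix, Definition A.3
(iii) (manuscript p. 82) [cite: MochizukiSemiAnbd2006, Def A.3(iii) p.82]: for a QD-pair `(A, Γ_A)`
an arrow `φ : A → B` "forms a quotient — `B ≅ A/Γ_A` — if (a) `φ ∘ γ_A = φ` for all `γ_A ∈ Γ_A`;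
(b) every `Γ_A`-invariant arrow `ψ_A : A → C` factors uniquely through `φ`"; the proof of Theorem A.4
(p. 83) USES the assignment "`(B, Γ_B) ↦ B/Γ_B`" ("`q_i : D_i → T_i`") for QD-pairs of a connected
temperoid, i.e. that such quotients exist there.  The typed predicate is
`Literature.AnabelianGeometry.SemiGraphs.QDPair.IsQuotient` (`QuasiTemperoidsQDPairs.lean`, which
proves the printed uniqueness bracket).  THIS FILE supplies the EXISTENCE and the DESCRIPTION of
these quotients for the model temperoid `B^temp(Π)` (`BTemp Π`: countable discrete continuous
`Π`-sets, [SemiAnbd] §3 p. 33) and for its full subcategories `B^temp(Π)[Π/H] = BTempRel Π H`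
(objects admitting an arrow to `Π/H`; the `T[A]` of Definition A.1 (i)):

* `QDPair.orbitSetoid`, `QDPair.OrbitSpace`, `QDPair.orbitQuotient` — for `P = (X, Γ)` a QD-pair of
  `B^temp(Π)`: the orbit space `X/Γ` of the underlying `Π`-set under the subgroup `Γ ⊆ Aut(X)` of
  `Π`-automorphisms, with the induced `Π`-action (well defined because `Γ` commutes with `Π`); it is
  countable, and its stabilisers are open because `Stab_Π([x]) ⊇ Stab_Π(x)` — NO temperedness of `Π`
  is needed, only that `Π` is a topological group;
* `QDPair.orbitQuotientπ : X ⟶ X/Γ`, `QDPair.orbitQuotientDesc` (descent of `Γ`-invariant arrows),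
  **`QDPair.isQuotient_orbitQuotientπ`**: `X → X/Γ` forms a quotient of `(X, Γ)` in the sense of
  Def. A.3 (iii); hence **`QDPair.exists_isQuotient`**: every QD-pair of `B^temp(Π)` has a quotient;
* the CRITERION **`QDPair.isQuotient_iff_surjective`**: `φ : X → B` forms a quotient of `(X, Γ)` iff
  `φ` is `Γ`-invariant, surjective on points, and its fibres are the `Γ`-orbits (so a quotient is,
  up to the unique isomorphism of Def. A.3 (iii), the orbit space);
* the `T[A] = B^temp(Π)[Π/H]` half (when does a quotient exist in the subcategory, and that it is then
  the same orbit space) is the sequel `BTempQDPairQuotientsRel.lean`.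

Everything here is elementary `Π`-set theory recorded for the tree's model of temperoids; nothing
refers to the IUT corpus and no side is taken on any disputed claim.  Every lemma below is a step
of (the existence half of) Def. A.3 (iii) p. 82 and carries that locator.
-/

open CategoryTheory CategoryTheory.Limits Topology

namespace Literature.AnabelianGeometry.SemiGraphs

open Literature.AlgebraicGeometry.Frobenioids.QuasiTemperoid (BTempRel cosetAction admitsHomToCoset)
open Literature.AlgebraicGeometry.Frobenioids.QuasiTemperoid.BTempConnected (hom_ρ hom_ext_apply
  ρ_one_apply ρ_mul_apply ρ_inv_apply ρ_apply_inv)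

universe u

variable {G : Type u} [Group G] [TopologicalSpace G]

namespace QDPair

/-! ### Automorphisms of an object of `B^temp(Π)` acting on its points -/

section AutApply

variable {X : BTemp G}

/-- Pointwise composition in `B^temp(Π)`. [folklore] -/
private theorem btemp_comp_apply {Y Z : BTemp G} (f : X ⟶ Y) (g : Y ⟶ Z) (x : X.obj.V) :
    ((f ≫ g).hom.hom x : Z.obj.V) = g.hom.hom (f.hom.hom x) := rfl

/-- The product of two automorphisms acts as the composite (`(γ * δ) = δ ≫ γ`). [folklore] -/
private theorem aut_mul_apply (γ δ : Aut X) (x : X.obj.V) :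
    ((γ * δ).hom.hom.hom x : X.obj.V) = γ.hom.hom.hom (δ.hom.hom.hom x) := rfl

/-- The identity automorphism acts trivially. [folklore] -/
private theorem aut_one_apply (x : X.obj.V) : ((1 : Aut X).hom.hom.hom x : X.obj.V) = x := rfl

/-- `γ⁻¹` undoes `γ` on points. [folklore] -/
private theorem aut_inv_apply_self (γ : Aut X) (x : X.obj.V) :
    ((γ⁻¹).hom.hom.hom (γ.hom.hom.hom x) : X.obj.V) = x := by
  change ((γ.hom ≫ γ.inv).hom.hom x : X.obj.V) = x
  rw [γ.hom_inv_id]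
  rfl

/-- `γ` undoes `γ⁻¹` on points. [folklore] -/
private theorem aut_apply_inv_self (γ : Aut X) (x : X.obj.V) :
    (γ.hom.hom.hom ((γ⁻¹).hom.hom.hom x) : X.obj.V) = x := by
  change ((γ.inv ≫ γ.hom).hom.hom x : X.obj.V) = x
  rw [γ.inv_hom_id]
  rfl

/-- Automorphisms of `B^temp(Π)` commute with the `Π`-action. [folklore] -/
private theorem aut_apply_ρ (γ : Aut X) (g : G) (x : X.obj.V) :
    (γ.hom.hom.hom (X.obj.ρ g x) : X.obj.V) = X.obj.ρ g (γ.hom.hom.hom x) :=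
  hom_ρ γ.hom g x

end AutApply

/-! ### The orbit space `X/Γ` of a QD-pair of `B^temp(Π)` -/

section OrbitSpace

variable (P : QDPair (BTemp G))

/-- The `Γ`-orbit relation on the points of `X` for a QD-pair `P = (X, Γ)` of `B^temp(Π)`:
`x ~ y` iff `γ(x) = y` for some `γ ∈ Γ`. [cite: MochizukiSemiAnbd2006, Def A.3(iii) p.82] -/
def orbitSetoid : Setoid P.A.obj.V where
  r x y := ∃ γ ∈ P.Γ, (γ.hom.hom.hom x : P.A.obj.V) = y
  iseqv :=
    { refl := fun x => ⟨1, P.Γ.one_mem, aut_one_apply x⟩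
      symm := by
        rintro x y ⟨γ, hγ, rfl⟩
        exact ⟨γ⁻¹, P.Γ.inv_mem hγ, aut_inv_apply_self γ x⟩
      trans := by
        rintro x y z ⟨γ, hγ, rfl⟩ ⟨δ, hδ, rfl⟩
        exact ⟨δ * γ, P.Γ.mul_mem hδ hγ, aut_mul_apply δ γ x⟩ }

/-- The orbit space `X/Γ` (as a type) of a QD-pair `(X, Γ)` of `B^temp(Π)`. [cite: MochizukiSemiAnbd2006, Def A.3(iii) p.82] -/
def OrbitSpace : Type u := Quotient P.orbitSetoid

/-- The class map `X → X/Γ`. [cite: MochizukiSemiAnbd2006, Def A.3(iii) p.82] -/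
def orbitMk (x : P.A.obj.V) : P.OrbitSpace := Quotient.mk P.orbitSetoid x

/-- The class map is surjective. [cite: MochizukiSemiAnbd2006, Def A.3(iii) p.82] -/
theorem orbitMk_surjective : Function.Surjective P.orbitMk :=
  Quotient.mk_surjective

/-- Two points have the same class iff they lie in one `Γ`-orbit. [cite: MochizukiSemiAnbd2006, Def A.3(iii) p.82] -/
theorem orbitMk_eq_iff {x y : P.A.obj.V} :
    P.orbitMk x = P.orbitMk y ↔ ∃ γ ∈ P.Γ, (γ.hom.hom.hom x : P.A.obj.V) = y :=
  Quotient.eq (r := P.orbitSetoid)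

/-- An element of `Γ` does not change the class. [cite: MochizukiSemiAnbd2006, Def A.3(iii) p.82] -/
theorem orbitMk_aut_apply {γ : Aut P.A} (hγ : γ ∈ P.Γ) (x : P.A.obj.V) :
    P.orbitMk (γ.hom.hom.hom x) = P.orbitMk x :=
  (P.orbitMk_eq_iff.mpr ⟨γ, hγ, rfl⟩).symm

/-- The `Π`-action descends to the orbit space: `g · [x] := [g · x]` (well defined because every
`γ ∈ Γ ⊆ Aut(X)` is `Π`-equivariant). [cite: MochizukiSemiAnbd2006, Def A.3(iii) p.82] -/
def orbitAct (g : G) : P.OrbitSpace → P.OrbitSpace :=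
  Quotient.map' (P.A.obj.ρ g) (by
    rintro x y ⟨γ, hγ, rfl⟩
    exact ⟨γ, hγ, aut_apply_ρ γ g x⟩)

/-- `g · [x] = [g · x]`. [cite: MochizukiSemiAnbd2006, Def A.3(iii) p.82] -/
theorem orbitAct_orbitMk (g : G) (x : P.A.obj.V) :
    P.orbitAct g (P.orbitMk x) = P.orbitMk (P.A.obj.ρ g x) := rfl

/-- The induced `Π`-action on `X/Γ` (as a `MulAction`; used to build the object, not registered as
an instance). [cite: MochizukiSemiAnbd2006, Def A.3(iii) p.82] -/
@[reducible] def orbitSpaceMulAction : MulAction G P.OrbitSpace where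
  smul g := P.orbitAct g
  one_smul q := by
    induction q using Quotient.ind with
    | _ x => exact congrArg P.orbitMk (ρ_one_apply P.A x)
  mul_smul g h q := by
    induction q using Quotient.ind with
    | _ x => exact congrArg P.orbitMk (ρ_mul_apply P.A g h x)

variable [IsTopologicalGroup G]

/-- **The quotient object `X/Γ` of `B^temp(Π)`** for a QD-pair `(X, Γ)`: the orbit space with its
induced `Π`-action is again a countable discrete continuous `Π`-set — countable as a quotient of a
countable set, with open stabilisers because `Stab_Π([x])` contains the open subgroup `Stab_Π(x)`.
(`Π` any topological group; used for `Π` tempered in [SemiAnbd].)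
[cite: MochizukiSemiAnbd2006, Def A.3(iii) p.82] -/
def orbitQuotient : BTemp G :=
  ⟨@Action.ofMulAction G P.OrbitSpace _ P.orbitSpaceMulAction, by
    letI : MulAction G P.OrbitSpace := P.orbitSpaceMulAction
    refine ⟨?_, ?_⟩
    · haveI : Countable P.A.obj.V := P.A.property.1
      exact P.orbitMk_surjective.countable
    · intro q
      induction q using Quotient.ind with
      | _ x =>
        letI : MulAction G P.A.obj.V := Action.instMulAction P.A.obj
        have hle : MulAction.stabilizer G x ≤ MulAction.stabilizer G (P.orbitMk x) := by
          intro g hg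
          rw [MulAction.mem_stabilizer_iff] at hg ⊢
          change P.orbitAct g (P.orbitMk x) = P.orbitMk x
          rw [orbitAct_orbitMk]
          exact congrArg P.orbitMk hg
        have hopen : IsOpen (MulAction.stabilizer G (P.orbitMk x) : Set G) :=
          Subgroup.isOpen_mono hle (P.A.property.2 x)
        exact hopen⟩

/-- The action on the quotient object, unfolded. [cite: MochizukiSemiAnbd2006, Def A.3(iii) p.82] -/
theorem orbitQuotient_ρ_apply (g : G) (x : P.A.obj.V) :
    (P.orbitQuotient.obj.ρ g (P.orbitMk x) : P.orbitQuotient.obj.V) = P.orbitMk (P.A.obj.ρ g x) :=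
  rfl

/-- **The quotient arrow `X → X/Γ`** of `B^temp(Π)`. [cite: MochizukiSemiAnbd2006, Def A.3(iii) p.82] -/
def orbitQuotientπ : P.A ⟶ P.orbitQuotient :=
  ObjectProperty.homMk
    { hom := TypeCat.ofHom P.orbitMk
      comm := fun g => by
        apply ConcreteCategory.hom_ext
        intro x
        rfl }

/-- The quotient arrow is the class map on points. [cite: MochizukiSemiAnbd2006, Def A.3(iii) p.82] -/
@[simp] theorem orbitQuotientπ_apply (x : P.A.obj.V) :
    (P.orbitQuotientπ.hom.hom x : P.orbitQuotient.obj.V) = P.orbitMk x := rfl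

/-- Def. A.3 (iii) (a) for `X → X/Γ`: `γ ≫ π = π` for `γ ∈ Γ`. [cite: MochizukiSemiAnbd2006, Def A.3(iii) p.82] -/
theorem aut_comp_orbitQuotientπ {γ : Aut P.A} (hγ : γ ∈ P.Γ) :
    γ.hom ≫ P.orbitQuotientπ = P.orbitQuotientπ :=
  hom_ext_apply fun x => P.orbitMk_aut_apply hγ x

/-- **Descent of `Γ`-invariant arrows**: an arrow `ψ : X → C` of `B^temp(Π)` with `γ ≫ ψ = ψ` for all
`γ ∈ Γ` factors through `X/Γ`. [cite: MochizukiSemiAnbd2006, Def A.3(iii) p.82] -/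
def orbitQuotientDesc {C : BTemp G} (ψ : P.A ⟶ C) (hψ : ∀ γ ∈ P.Γ, γ.hom ≫ ψ = ψ) :
    P.orbitQuotient ⟶ C :=
  ObjectProperty.homMk
    { hom := TypeCat.ofHom (Quotient.lift (fun x => (ψ.hom.hom x : C.obj.V)) (by
        rintro x y ⟨γ, hγ, rfl⟩
        exact (congrArg (fun χ : P.A ⟶ C => (χ.hom.hom x : C.obj.V)) (hψ γ hγ)).symm))
      comm := fun g => by
        apply ConcreteCategory.hom_ext
        intro q
        induction q using Quotient.ind with
        | _ x => exact hom_ρ ψ g x }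

/-- The descended arrow on classes. [cite: MochizukiSemiAnbd2006, Def A.3(iii) p.82] -/
@[simp] theorem orbitQuotientDesc_apply {C : BTemp G} (ψ : P.A ⟶ C)
    (hψ : ∀ γ ∈ P.Γ, γ.hom ≫ ψ = ψ) (x : P.A.obj.V) :
    ((P.orbitQuotientDesc ψ hψ).hom.hom (P.orbitMk x) : C.obj.V) = ψ.hom.hom x := rfl

/-- Def. A.3 (iii) (b), existence: `π ≫ desc ψ = ψ`. [cite: MochizukiSemiAnbd2006, Def A.3(iii) p.82] -/
theorem orbitQuotientπ_desc {C : BTemp G} (ψ : P.A ⟶ C) (hψ : ∀ γ ∈ P.Γ, γ.hom ≫ ψ = ψ) :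
    P.orbitQuotientπ ≫ P.orbitQuotientDesc ψ hψ = ψ :=
  hom_ext_apply fun _ => rfl

/-- Def. A.3 (iii) (b), uniqueness: an arrow out of `X/Γ` is determined by its composite with `π`.
[cite: MochizukiSemiAnbd2006, Def A.3(iii) p.82] -/
theorem orbitQuotient_hom_ext {C : BTemp G} {χ χ' : P.orbitQuotient ⟶ C}
    (h : P.orbitQuotientπ ≫ χ = P.orbitQuotientπ ≫ χ') : χ = χ' :=
  hom_ext_apply fun q => by
    induction q using Quotient.ind with
    | _ x => exact congrArg (fun ψ : P.A ⟶ C => (ψ.hom.hom x : C.obj.V)) h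

/-- **Definition A.3 (iii), EXISTENCE in `B^temp(Π)`: `X → X/Γ` forms a quotient of the QD-pair
`(X, Γ)`** — (a) it is `Γ`-invariant, (b) every `Γ`-invariant arrow `X → C` factors uniquely
through it. [cite: MochizukiSemiAnbd2006, Def A.3(iii) p.82] -/
theorem isQuotient_orbitQuotientπ : P.IsQuotient P.orbitQuotientπ :=
  ⟨fun _ hγ => P.aut_comp_orbitQuotientπ hγ, fun _ ψ hψ =>
    ⟨P.orbitQuotientDesc ψ hψ, P.orbitQuotientπ_desc ψ hψ, fun _ hχ =>
      P.orbitQuotient_hom_ext (hχ.trans (P.orbitQuotientπ_desc ψ hψ).symm)⟩⟩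

/-- **Every QD-pair of `B^temp(Π)` has a quotient** (the "`B/Γ_B`" of the proof of Thm. A.4, p. 83,
for the temperoid `B^temp(Π)`). [cite: MochizukiSemiAnbd2006, Def A.3(iii) p.82] -/
theorem exists_isQuotient : ∃ (B : BTemp G) (φ : P.A ⟶ B), P.IsQuotient φ :=
  ⟨P.orbitQuotient, P.orbitQuotientπ, P.isQuotient_orbitQuotientπ⟩

end OrbitSpace

/-! ### The criterion: quotients are the `Γ`-invariant surjections with `Γ`-orbits as fibres -/

section Criterion

variable {P : QDPair (BTemp G)}

omit [TopologicalSpace G] in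
/-- Quotients are stable under isomorphisms of the target. [cite: MochizukiSemiAnbd2006, Def A.3(iii) p.82] -/
theorem IsQuotient.of_iso {Q : Type*} [Category Q] {P : QDPair Q} {B B' : Q} {φ : P.A ⟶ B}
    (h : P.IsQuotient φ) (e : B ≅ B') : P.IsQuotient (φ ≫ e.hom) := by
  refine ⟨fun γ hγ => by rw [← Category.assoc, h.1 γ hγ], fun C ψ hψ => ?_⟩
  obtain ⟨ψ', hψ', huniq⟩ := h.2 ψ hψ
  refine ⟨e.inv ≫ ψ', ?_, fun χ hχ => ?_⟩
  · show (φ ≫ e.hom) ≫ e.inv ≫ ψ' = ψ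
    rw [Category.assoc, e.hom_inv_id_assoc, hψ']
  · have hχ' : φ ≫ (e.hom ≫ χ) = ψ := by rw [← Category.assoc]; exact hχ
    rw [← huniq _ hχ', e.inv_hom_id_assoc]

variable [IsTopologicalGroup G]

/-- A quotient of `(X, Γ)` in `B^temp(Π)` is, up to a unique isomorphism under `X`, the orbit space
`X/Γ` (Def. A.3 (iii) bracket, made explicit). [cite: MochizukiSemiAnbd2006, Def A.3(iii) p.82] -/
theorem IsQuotient.existsUnique_iso_orbitQuotient {B : BTemp G} {φ : P.A ⟶ B} (h : P.IsQuotient φ) :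
    ∃! e : P.orbitQuotient ≅ B, P.orbitQuotientπ ≫ e.hom = φ :=
  P.isQuotient_orbitQuotientπ.existsUnique_iso h

/-- A quotient arrow is surjective on points. [cite: MochizukiSemiAnbd2006, Def A.3(iii) p.82] -/
theorem IsQuotient.surjective {B : BTemp G} {φ : P.A ⟶ B} (h : P.IsQuotient φ) :
    Function.Surjective fun x : P.A.obj.V => (φ.hom.hom x : B.obj.V) := by
  obtain ⟨e, he, -⟩ := h.existsUnique_iso_orbitQuotient
  subst he
  intro b
  obtain ⟨x, hx⟩ := P.orbitMk_surjective (e.inv.hom.hom b)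
  refine ⟨x, ?_⟩
  change (e.hom.hom.hom (P.orbitQuotientπ.hom.hom x) : B.obj.V) = b
  rw [orbitQuotientπ_apply, hx]
  change ((e.inv ≫ e.hom).hom.hom b : B.obj.V) = b
  rw [e.inv_hom_id]
  rfl

/-- The fibres of a quotient arrow are exactly the `Γ`-orbits. [cite: MochizukiSemiAnbd2006, Def A.3(iii) p.82] -/
theorem IsQuotient.apply_eq_iff {B : BTemp G} {φ : P.A ⟶ B} (h : P.IsQuotient φ) {x y : P.A.obj.V} :
    (φ.hom.hom x : B.obj.V) = φ.hom.hom y ↔ ∃ γ ∈ P.Γ, (γ.hom.hom.hom x : P.A.obj.V) = y := by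
  obtain ⟨e, he, -⟩ := h.existsUnique_iso_orbitQuotient
  subst he
  rw [← P.orbitMk_eq_iff]
  change (e.hom.hom.hom (P.orbitQuotientπ.hom.hom x) : B.obj.V) =
      e.hom.hom.hom (P.orbitQuotientπ.hom.hom y) ↔ _
  rw [orbitQuotientπ_apply, orbitQuotientπ_apply]
  have hinj : Function.Injective fun q : P.orbitQuotient.obj.V => (e.hom.hom.hom q : B.obj.V) :=
    Function.LeftInverse.injective (g := fun b : B.obj.V => (e.inv.hom.hom b : P.orbitQuotient.obj.V))
      fun q => by
        change ((e.hom ≫ e.inv).hom.hom q : P.orbitQuotient.obj.V) = q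
        rw [e.hom_inv_id]
        rfl
  constructor
  · intro hxy
    exact hinj hxy
  · intro hxy
    rw [hxy]

/-- **The criterion.** An arrow `φ : X → B` of `B^temp(Π)` forms a quotient of the QD-pair `(X, Γ)`
iff it is `Γ`-invariant, surjective on points, and identifies two points only when they lie in one
`Γ`-orbit. [cite: MochizukiSemiAnbd2006, Def A.3(iii) p.82] -/
theorem isQuotient_iff_surjective {B : BTemp G} (φ : P.A ⟶ B) :
    P.IsQuotient φ ↔ (∀ γ ∈ P.Γ, γ.hom ≫ φ = φ) ∧
      Function.Surjective (fun x : P.A.obj.V => (φ.hom.hom x : B.obj.V)) ∧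
      ∀ x y : P.A.obj.V, (φ.hom.hom x : B.obj.V) = φ.hom.hom y →
        ∃ γ ∈ P.Γ, (γ.hom.hom.hom x : P.A.obj.V) = y := by
  constructor
  · intro h
    exact ⟨h.1, h.surjective, fun x y => h.apply_eq_iff.mp⟩
  · rintro ⟨hinv, hsurj, hfib⟩
    -- the descended arrow `X/Γ → B` is a bijection, hence an isomorphism of `B^temp(Π)`
    let d : P.orbitQuotient ⟶ B := P.orbitQuotientDesc φ hinv
    have hd_bij : Function.Bijective fun q : P.orbitQuotient.obj.V => (d.hom.hom q : B.obj.V) := by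
      constructor
      · intro q q'
        induction q using Quotient.ind with
        | _ x =>
          induction q' using Quotient.ind with
          | _ y =>
            intro hq
            exact P.orbitMk_eq_iff.mpr (hfib x y hq)
      · intro b
        obtain ⟨x, hx⟩ := hsurj b
        exact ⟨P.orbitMk x, hx⟩
    haveI : IsIso d.hom.hom := (isIso_iff_bijective d.hom.hom).mpr hd_bij
    haveI : IsIso d.hom := Action.isIso_of_hom_isIso d.hom
    haveI : IsIso d := ((temperedAction G).isIso_hom_iff d).mp inferInstance
    have hq := P.isQuotient_orbitQuotientπ.of_iso (asIso d)
    rwa [asIso_hom, P.orbitQuotientπ_desc φ hinv] at hq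

end Criterion

end QDPair

end Literature.AnabelianGeometry.SemiGraphs
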